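/-
Copyright: pub-hodgecm formalisation cell (harness21, 2026). New file (not vendored).
-/
import Summits.HodgeConjecture.HodgeCM.Proofs.Prop22.Algebraic_2

/-!
# rfwf Prop 2.2 `prop:weil` — the surface criterion, assembled

`HodgeCM.Universe.surfaceCriterion_holds (M : U.ModelAxioms) : U.SurfaceCriterion`, from
* Steps A–D (`HodgeCM.Proofs.Prop22.Dictionary.exists_weilGen_pullback`): the period data give a morphism
  `fP : S → P(f)` and an `ι₁`-Weil generator `y` with `∫_S fP^* y = ` the period;
* Step E (M26, `gysinC`): `∫_S fP^* y = ∫_{P(f)} y ∪ cl(fP_*[S])` with `cl(fP_*[S])` algebraic;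
* Step F (`HodgeCM.Proofs.Prop22.Algebraic.weilLine_le_alg_of_detect`): a Weil generator pairing
  non-trivially with an algebraic class forces `W_F(P(f)) ⊆ Alg²(P(f))`.
The gen-1–3 stub `HodgeCM.StubTree.prop22_surfaceCriterion` is now this theorem (`StubTree.Reduction`).
The whole Prop 2.2 sub-tree (`HodgeCM/Proofs/Prop22/*`, this file) has no placeholder proofs; its only hypotheses are
the model facts `M : U.ModelAxioms` (uses M1, M2, M7, M11, M13, M18–M28; SKELETON.md §3, FACTS.md §1).
-/

noncomputable section

namespace HodgeCM

namespace Universe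

variable {U : Universe}

/-- **rfwf Prop 2.2** (surface criterion) in the `Universe` model, from the model facts M1–M28. -/
theorem surfaceCriterion_holds (M : U.ModelAxioms) : U.SurfaceCriterion := by
  intro F _ f ι₁ _ S hS Fm α hα hper
  obtain ⟨fP, c, hc, htr⟩ := exists_weilGen_pullback M F f ι₁ S Fm α hα
  obtain ⟨z, hz, hgys⟩ := gysinC M S (U.prod4 F f.corner) fP hS
  have hne : U.Bc F f.corner (U.weilGen F f.corner c) z ≠ 0 := by
    rw [Bc, ← hgys, htr]; exact hper
  exact weilLine_le_alg_of_detect M ι₁ c hc z hz hne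

end Universe

end HodgeCM

end
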